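import Summits.AtomisticToContinuum.BoseEinsteinCondensation.Theorems.DensityResponse.Negative.Tightness
import Summits.AtomisticToContinuum.BoseEinsteinCondensation.Theorems.BECThomsonPrincipleDensityResponseKineticSignCoherence

/-!
# `DensityResponse` — the scattering length is only a switch (crux disprover, generation 3)

Negative/structural lemmas for the crux `DensityResponse` (stmt-AtomisticToContinuum-9481, route
`BECThomsonPrinciple`), supporting the item; nothing here asserts a Theses statement positively
(the equivalences restate the crux, the refutations concern variants).  Companion file
`ThresholdAndCeiling.lean`: `N₀` is decoration, large tilts are free under an energy ceiling.

Write `HoldsWith v b M ρ₀ C N₀` for the crux's inner conclusion for the potential `v` with the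
Bogoliubov denominator `k∞² + ρ·b`, `ρ = N/L³`, at a free STIFFNESS PARAMETER `b` (the crux is
`∀ v ∀ M ∃ ρ₀ C N₀, HoldsWith v a(v) M ρ₀ C N₀`, `a(v) = (scatteringLength v).toReal`;
`densityResponse_iff_holdsWith`).

* `HoldsWith.stiffness`: for `b, b' > 0`, `HoldsWith v b … C … → HoldsWith v b' … (C·max 1 (b'/b)) …` —
  since `C` is existential AFTER `v`, any two positive stiffness parameters are interchangeable.
* `holdsWith_zero_of_ae`: if `v(|x|) = 0` a.e. (equivalently `a(v) = 0`, LSSY App. C) the conclusion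
  holds with `b = 0`, `C = 4` (the free chord `free_chord_energy` + `E₀^per(v) = 0`).
* `not_holdsWith_of_ae_pos`: if `v(|x|) = 0` a.e. then NO positive stiffness is admissible:
  `¬ HoldsWith v b M ρ₀ C N₀` for every `b, M, ρ₀, C > 0`, `N₀` — one-phonon product states
  `∏ᵢ c(1 + cos(2πx_{i,0}/L))` at `L → ∞`, `ρ ∈ [ρ₀/2, ρ₀]`, `k = 2π/L`, tilt `s = k²/2`: the free
  response `χ/N = 2/k²` beats `2C/(k² + ρb)` as soon as `4ρb > 3Ck²`.
* `densityResponse_iff_stiffness` / `densityResponse_iff_unit`: for every fixed `b > 0`,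
  `DensityResponse ↔ ∀ v admissible, a(v) ≠ 0 → ∀ M > 0, ∃ ρ₀ C N₀, HoldsWith v b M ρ₀ C N₀`.
  THE SCATTERING LENGTH ENTERS THE CRUX ONLY AS THE SWITCH `a(v) = 0 ∨ a(v) > 0`: for `a(v) = 0` the
  crux is the (proved) free chord; for `a(v) > 0` it is the statement that SOME `ρ`-proportional
  stiffness `χ(k) ≤ 2CN/(k² + ρ)` holds uniformly down the density scale — no `8πa` and no
  `a`-dependence at all has to be produced by a proof, but the proof must DETECT `a(v) > 0`
  (`not_stiffness_without_pos`: the unit-stiffness form without the guard `a(v) ≠ 0` is false, by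
  `v = 0`).  Message to provers: the target is the qualitative incompressibility statement
  "`v ≠ 0` a.e. ⟹ modulus `≳_v ρ`", uniform in `(N/ρ₀)^{1/3} ≤ L ≤ M²N/(4π²)`; conversely the
  `a`-free form (`b = 0`, response `≤ 2CN/k∞²` relative to `E₀(v)`) is implied (`HoldsWith.anti`) and
  is itself not known in the thermodynamic regime.

References: LSSY 2005 (The Mathematics of the Bose Gas), App. C Thm C.1 (`a = 0 ⟹ v = 0` a.e.,
in tree `LSSY2005_zeroScatteringLength_holds`; `a ≤ R₀ < ∞`, `scatteringLength_ne_top_of_finiteRange`).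
-/

noncomputable section

open MeasureTheory Set Filter Metric
open scoped ENNReal NNReal BigOperators Classical

namespace Summit.AtomisticToContinuum.BoseEinsteinCondensation.Theorems.DensityResponse.Negative

open Literature.MathematicalPhysics.QuantumManyBody.BoseGas
open Summit.AtomisticToContinuum.BoseEinsteinCondensation.Theses.BECThomsonPrinciple (DensityResponse)
open Summit.AtomisticToContinuum.BoseEinsteinCondensation.Cruxes.DensityResponse.ForceBalanceConstitutive
  (periodicGroundStateEnergy_eq_zero_of_ae periodicEnergy_eq_ofReal_of_ae)

section UnitStiffness

/-- The crux's inner conclusion for the potential `v`, window `M`, constants `(ρ₀, C, N₀)` and a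
free STIFFNESS PARAMETER `b` in the Bogoliubov denominator `k∞² + (N/L³)·b` (the crux takes
`b = (scatteringLength v).toReal`; `HoldsFree M ρ₀ C N₀` is `HoldsWith 0 0 M ρ₀ C N₀`).  (Notation of
this file for variants of the crux's conclusion — not a literature fact; deliberately untagged.) -/
def HoldsWith (v : ℝ → ℝ≥0∞) (b M ρ₀ C : ℝ) (N₀ : ℕ) : Prop :=
  ∀ N : ℕ, N₀ ≤ N → ∀ L : ℝ, 0 < L → (N : ℝ) ≤ ρ₀ * L ^ 3 → ∀ n : Fin 3 → ℤ, n ≠ 0 →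
    2 * Real.pi * ‖(fun j => (n j : ℝ))‖ / L ≤ M * Real.sqrt (N / L ^ 3) → ∀ s : ℝ, 0 ≤ s →
    ∀ Φ : PeriodicTrialState N L,
      periodicGroundStateEnergy v N L + ENNReal.ofReal (s * |∫ X in cellN N L,
        (∑ i, 2 * Real.cos (2 * Real.pi / L * ∑ j, (n j : ℝ) * X i j)) * ‖Φ.ψ X‖ ^ 2|) ≤
      periodicEnergy v Φ + ENNReal.ofReal (C * s ^ 2 * N /
        ((2 * Real.pi * ‖(fun j => (n j : ℝ))‖ / L) ^ 2 + N / L ^ 3 * b))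

/-- The crux, read through `HoldsWith` (definitional). [folklore] -/
theorem densityResponse_iff_holdsWith :
    DensityResponse ↔ ∀ v : ℝ → ℝ≥0∞, IsRepulsiveFiniteRange v → ∀ M : ℝ, 0 < M →
      ∃ ρ₀ C : ℝ, 0 < ρ₀ ∧ 0 < C ∧ ∃ N₀ : ℕ, HoldsWith v (scatteringLength v).toReal M ρ₀ C N₀ :=
  Iff.rfl

/-- `HoldsFree` (Tightness) is `HoldsWith 0 0`. [folklore] -/
theorem holdsFree_iff_holdsWith {M ρ₀ C : ℝ} {N₀ : ℕ} :
    HoldsFree M ρ₀ C N₀ ↔ HoldsWith 0 0 M ρ₀ C N₀ := by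
  unfold HoldsFree HoldsWith
  rw [scatteringLength_zero, ENNReal.toReal_zero]

/-- Comparison of two right-hand sides `C s²N/(q + ρb)` (pure arithmetic). [folklore] -/
theorem rhs_le_rhs {C C' b b' q ρ s N : ℝ} (hq : 0 < q) (hρ : 0 ≤ ρ) (hb : 0 ≤ b) (hb' : 0 ≤ b')
    (hN : 0 ≤ N) (h : C * (q + ρ * b') ≤ C' * (q + ρ * b)) :
    C * s ^ 2 * N / (q + ρ * b) ≤ C' * s ^ 2 * N / (q + ρ * b') := by
  rw [div_le_div_iff₀ (by positivity) (by positivity)]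
  have hsN : 0 ≤ s ^ 2 * N := by positivity
  calc C * s ^ 2 * N * (q + ρ * b') = s ^ 2 * N * (C * (q + ρ * b')) := by ring
    _ ≤ s ^ 2 * N * (C' * (q + ρ * b)) := mul_le_mul_of_nonneg_left h hsN
    _ = C' * s ^ 2 * N * (q + ρ * b) := by ring

/-- Transfer of the conclusion along a comparison of constants and stiffness parameters. [folklore] -/
theorem HoldsWith.of_le {v : ℝ → ℝ≥0∞} {b b' M ρ₀ C C' : ℝ} {N₀ : ℕ} (hb : 0 ≤ b) (hb' : 0 ≤ b')
    (hCC : ∀ q ρ : ℝ, 0 < q → 0 ≤ ρ → C * (q + ρ * b') ≤ C' * (q + ρ * b))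
    (h : HoldsWith v b M ρ₀ C N₀) : HoldsWith v b' M ρ₀ C' N₀ := by
  intro N hN L hL hdil n hn hwin s hs Φ
  refine (h N hN L hL hdil n hn hwin s hs Φ).trans (add_le_add le_rfl (ENNReal.ofReal_le_ofReal ?_))
  have hq : 0 < (2 * Real.pi * ‖(fun j => (n j : ℝ))‖ / L) ^ 2 := pow_pos (kinf_pos hL hn) 2
  exact rhs_le_rhs hq (by positivity) hb hb' (Nat.cast_nonneg N) (hCC _ _ hq (by positivity))

/-- Monotonicity in the constant. [folklore] -/
theorem HoldsWith.mono {v : ℝ → ℝ≥0∞} {b M ρ₀ C C' : ℝ} {N₀ : ℕ} (hb : 0 ≤ b) (hCC : C ≤ C')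
    (h : HoldsWith v b M ρ₀ C N₀) : HoldsWith v b M ρ₀ C' N₀ :=
  h.of_le hb hb fun q ρ hq hρ => mul_le_mul_of_nonneg_right hCC (by positivity)

/-- Antitonicity in the stiffness parameter: a SMALLER stiffness is a WEAKER claim. [folklore] -/
theorem HoldsWith.anti {v : ℝ → ℝ≥0∞} {b b' M ρ₀ C : ℝ} {N₀ : ℕ} (hb' : 0 ≤ b') (hbb : b' ≤ b)
    (hC : 0 ≤ C) (h : HoldsWith v b M ρ₀ C N₀) : HoldsWith v b' M ρ₀ C N₀ :=
  h.of_le (hb'.trans hbb) hb' fun q ρ hq hρ => by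
    refine mul_le_mul_of_nonneg_left ?_ hC
    gcongr

/-- **Any two positive stiffness parameters are interchangeable** (the constant `C` is existential
after `v`): `HoldsWith v b … C … → HoldsWith v b' … (C · max 1 (b'/b)) …`. [folklore] -/
theorem HoldsWith.stiffness {v : ℝ → ℝ≥0∞} {b b' M ρ₀ C : ℝ} {N₀ : ℕ} (hb : 0 < b) (hb' : 0 < b')
    (hC : 0 ≤ C) (h : HoldsWith v b M ρ₀ C N₀) : HoldsWith v b' M ρ₀ (C * max 1 (b' / b)) N₀ := by
  refine h.of_le hb.le hb'.le fun q ρ hq hρ => ?_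
  rcases le_or_gt b' b with hle | hlt
  · calc C * (q + ρ * b') ≤ C * (q + ρ * b) := by gcongr
      _ = C * 1 * (q + ρ * b) := by ring
      _ ≤ C * max 1 (b' / b) * (q + ρ * b) := by gcongr; exact le_max_left _ _
  · have hmax : max 1 (b' / b) = b' / b := max_eq_right ((one_le_div hb).2 hlt.le)
    rw [hmax]
    have e : C * (b' / b) * (q + ρ * b) = C * (q * (b' / b) + ρ * b') := by
      field_simp
    rw [e]
    refine mul_le_mul_of_nonneg_left (add_le_add ?_ le_rfl) hC
    exact le_mul_of_one_le_right hq.le ((one_le_div hb).2 hlt.le)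

/-- **`a(v) = 0`: the conclusion holds with stiffness `0` and `C = 4`.** If `v(|x|) = 0` for a.e.
`x ∈ ℝ³` (for admissible `v` this is `scatteringLength v = 0`, LSSY App. C), then
`E₀^per(v) = 0`, `E_v(Φ) = E_0(Φ)` and the free chord `free_chord_energy` is the claim. [folklore] -/
theorem holdsWith_zero_of_ae {v : ℝ → ℝ≥0∞} (hv : Measurable v) (hv0 : ∀ᵐ x : Space, v ‖x‖ = 0)
    (M ρ₀ : ℝ) (N₀ : ℕ) : HoldsWith v 0 M ρ₀ 4 N₀ := by
  intro N _ L hL _ n hn _ s hs Φ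
  rw [periodicGroundStateEnergy_eq_zero_of_ae hv hv0 N hL, zero_add, mul_zero, add_zero]
  exact free_chord_energy hL v hn hs Φ

/-- **`a(v) = 0`: NO positive stiffness is admissible.** If `v(|x|) = 0` a.e. then for every
`b, M, ρ₀, C > 0` and `N₀` the conclusion `HoldsWith v b M ρ₀ C N₀` FAILS: on the torus of integer
side `L = K → ∞` with `N = ⌈ρ₀K³/2⌉` particles (`ρ ∈ [ρ₀/2, ρ₀]`, window `2π/K ≤ M√ρ` for large
`K`), mode `n = e₀` (`k∞² = q = (2π/K)²`), the one-phonon product state `∏ᵢ c(1 + cos θᵢ)`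
(`prodStateη ½`: source `4N/3`, energy `qN/3`, `E₀^per = 0`) and tilt `s = q/2` give
`sA − E = qN/3 > Cq²N/(4(q + ρb))` as soon as `ρ b > Cq`, i.e. `K² > 6π²C/(ρ₀ b)`:
the free response `χ/N = 2/k²` is not `O(1/(k² + ρb))`. [folklore] -/
theorem not_holdsWith_of_ae_pos {v : ℝ → ℝ≥0∞} (hv : Measurable v) (hv0 : ∀ᵐ x : Space, v ‖x‖ = 0)
    {b M ρ₀ C : ℝ} (hb : 0 < b) (hM : 0 < M) (hρ₀ : 0 < ρ₀) (hC : 0 < C) (N₀ : ℕ) :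
    ¬ HoldsWith v b M ρ₀ C N₀ := by
  intro h
  have hπ := Real.pi_pos
  -- a large integer side `K`
  obtain ⟨K, hK⟩ := exists_nat_gt (max (max (max 1 (2 * (N₀ + 1) / ρ₀)) (8 * Real.pi ^ 2 / (M ^ 2 * ρ₀)))
    (6 * Real.pi ^ 2 * C / (ρ₀ * b)))
  have hK1 : (1 : ℝ) < K :=
    lt_of_le_of_lt ((le_max_left _ _).trans ((le_max_left _ _).trans (le_max_left _ _))) hK
  have hKN : 2 * (N₀ + 1) / ρ₀ < K :=
    lt_of_le_of_lt ((le_max_right _ _).trans ((le_max_left _ _).trans (le_max_left _ _))) hK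
  have hKM : 8 * Real.pi ^ 2 / (M ^ 2 * ρ₀) < K :=
    lt_of_le_of_lt ((le_max_right _ _).trans (le_max_left _ _)) hK
  have hKC : 6 * Real.pi ^ 2 * C / (ρ₀ * b) < K := lt_of_le_of_lt (le_max_right _ _) hK
  have hK0 : (0 : ℝ) < K := lt_trans one_pos hK1
  have hKK : (K : ℝ) ≤ (K : ℝ) ^ 2 := by nlinarith only [hK1]
  have hKKK : (K : ℝ) ≤ (K : ℝ) ^ 3 := by nlinarith only [hK1, hKK]
  -- the particle number `N = ⌈ρ₀K³/2⌉`, density in `[ρ₀/2, ρ₀]`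
  obtain ⟨x, hx_def⟩ : ∃ x : ℝ, x = ρ₀ * (K : ℝ) ^ 3 / 2 := ⟨_, rfl⟩
  have hx0 : 0 ≤ x := by rw [hx_def]; positivity
  have hxN : (N₀ : ℝ) + 1 ≤ x := by
    rw [hx_def]
    rw [div_lt_iff₀ hρ₀] at hKN
    nlinarith only [hKN, mul_le_mul_of_nonneg_left hKKK hρ₀.le]
  obtain ⟨N, hN_def⟩ : ∃ N : ℕ, N = ⌈x⌉₊ := ⟨_, rfl⟩
  have hNx : x ≤ N := by rw [hN_def]; exact Nat.le_ceil x
  have hNx' : (N : ℝ) < x + 1 := by rw [hN_def]; exact Nat.ceil_lt_add_one hx0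
  have hN0r : (0 : ℝ) ≤ N₀ := Nat.cast_nonneg _
  have hN0 : N₀ ≤ N := by
    have : (N₀ : ℝ) ≤ N := by linarith only [hxN, hNx]
    exact_mod_cast this
  have hNpos : (0 : ℝ) < N := by linarith only [hxN, hNx, hN0r]
  have hL : (0 : ℝ) < K := hK0
  have hdil : (N : ℝ) ≤ ρ₀ * (K : ℝ) ^ 3 := by
    rw [hx_def] at hNx' hxN
    linarith only [hNx', hxN, hN0r]
  have hρ : ρ₀ / 2 ≤ N / (K : ℝ) ^ 3 := by
    rw [le_div_iff₀ (by positivity)]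
    rw [hx_def] at hNx
    linarith only [hNx]
  -- the mode `n = e₀`
  obtain ⟨n, hn_def⟩ : ∃ n : Fin 3 → ℤ, n = Pi.single 0 1 := ⟨_, rfl⟩
  have hn : n ≠ 0 := by
    intro h0; have := congr_fun h0 0; simp [hn_def] at this
  have hnorm : ‖(fun j => (n j : ℝ))‖ = 1 := by
    have : (fun j => (n j : ℝ)) = Pi.single (0 : Fin 3) (1 : ℝ) := by
      funext j; simp only [hn_def, Pi.single_apply]; split_ifs <;> simp
    rw [this, Pi.norm_single, norm_one]
  have hphase : ∀ y : Space, 2 * Real.pi / (K : ℝ) * ∑ j, (n j : ℝ) * y j = θL (K : ℝ) y := by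
    intro y; simp [hn_def, Pi.single_apply, θL]
  obtain ⟨q, hq_def⟩ : ∃ q : ℝ, q = (2 * Real.pi / (K : ℝ)) ^ 2 := ⟨_, rfl⟩
  have hq : 0 < q := by rw [hq_def]; positivity
  have hqK : q * (K : ℝ) ^ 2 = 4 * Real.pi ^ 2 := by
    rw [hq_def]; field_simp; ring
  -- the window `2π/K ≤ M√ρ`, from `q ≤ M²ρ₀/2 ≤ M²ρ`
  have hqM : q ≤ M ^ 2 * (N / (K : ℝ) ^ 3) := by
    have h1 : q ≤ M ^ 2 * (ρ₀ / 2) := by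
      rw [div_lt_iff₀ (by positivity)] at hKM
      -- `8π² < K M²ρ₀ ≤ K² M²ρ₀` and `q K² = 4π²`
      have h2 : q * (K : ℝ) ^ 2 ≤ M ^ 2 * (ρ₀ / 2) * (K : ℝ) ^ 2 := by
        rw [hqK]
        nlinarith only [hKM, mul_le_mul_of_nonneg_left hKK (le_of_lt (by positivity : (0 : ℝ) < M ^ 2 * ρ₀))]
      exact le_of_mul_le_mul_right h2 (by positivity)
    exact h1.trans (by gcongr)
  have hwin : 2 * Real.pi * ‖(fun j => (n j : ℝ))‖ / (K : ℝ) ≤ M * Real.sqrt (N / (K : ℝ) ^ 3) := by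
    rw [hnorm, mul_one]
    calc 2 * Real.pi / (K : ℝ) = Real.sqrt q := by
          rw [hq_def, Real.sqrt_sq (by positivity)]
      _ ≤ Real.sqrt (M ^ 2 * (N / (K : ℝ) ^ 3)) := Real.sqrt_le_sqrt hqM
      _ = M * Real.sqrt (N / (K : ℝ) ^ 3) := by
          rw [Real.sqrt_mul (sq_nonneg _), Real.sqrt_sq hM.le]
  -- the test state and tilt
  obtain ⟨s, hs_def⟩ : ∃ s : ℝ, s = q / 2 := ⟨_, rfl⟩
  have hs : 0 ≤ s := by rw [hs_def]; positivity
  have key := h N hN0 (K : ℝ) hL hdil n hn hwin s hs (prodStateη (1 / 2) N hL)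
  have hsrc : ∫ X in cellN N (K : ℝ), (∑ i, 2 * Real.cos (2 * Real.pi / (K : ℝ) * ∑ j, (n j : ℝ) * X i j)) *
      ‖(prodStateη (1 / 2) N hL).ψ X‖ ^ 2 = N * (4 / 3) := by
    simp_rw [hphase]
    rw [source_prodStateη (1 / 2) N hL]
    norm_num
  have hE : periodicEnergy v (prodStateη (1 / 2) N hL) = ENNReal.ofReal (N * (q / 3)) := by
    rw [periodicEnergy_eq_ofReal_of_ae hv hv0,
      ← periodicEnergy_eq_ofReal_of_ae (w := 0) measurable_const (Filter.Eventually.of_forall fun _ => rfl),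
      periodicEnergy_zero_prodStateη, ← hq_def]
    congr 1
    ring
  have hden : (2 * Real.pi * ‖(fun j => (n j : ℝ))‖ / (K : ℝ)) ^ 2 + N / (K : ℝ) ^ 3 * b =
      q + N / (K : ℝ) ^ 3 * b := by
    rw [hnorm, mul_one, hq_def]
  have hA0 : (0 : ℝ) < N * (4 / 3) := by positivity
  rw [hsrc, hden, periodicGroundStateEnergy_eq_zero_of_ae hv hv0 N hL, zero_add, hE,
    abs_of_pos hA0, ← ENNReal.ofReal_add (by positivity) (by positivity),
    ENNReal.ofReal_le_ofReal_iff (by positivity), hs_def] at key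
  -- `key : (q/2)(4N/3) ≤ qN/3 + C(q/2)²N/(q + ρb)`, i.e. `4(q + ρb) ≤ 3Cq`; but `4ρb > 3Cq`:
  have hρb : 3 / 4 * C * q < N / (K : ℝ) ^ 3 * b := by
    have h1 : 3 / 4 * C * q < ρ₀ / 2 * b := by
      rw [div_lt_iff₀ (by positivity)] at hKC
      -- `6π²C < Kρ₀b ≤ K²ρ₀b` and `qK² = 4π²`
      have h2 : 3 / 4 * C * q * (K : ℝ) ^ 2 < ρ₀ / 2 * b * (K : ℝ) ^ 2 := by
        have e : 3 / 4 * C * q * (K : ℝ) ^ 2 = 3 * C * Real.pi ^ 2 := by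
          rw [mul_assoc, hqK]; ring
        rw [e]
        nlinarith only [hKC, mul_le_mul_of_nonneg_left hKK (mul_pos hρ₀ hb).le]
      exact lt_of_mul_lt_mul_right h2 (by positivity)
    exact h1.trans_le (by gcongr)
  have hden0 : 0 < q + N / (K : ℝ) ^ 3 * b := by positivity
  have key2 : q / 2 * (N * (4 / 3)) - N * (q / 3) ≤ C * (q / 2) ^ 2 * N / (q + N / (K : ℝ) ^ 3 * b) := by
    linarith only [key]
  rw [le_div_iff₀ hden0] at key2
  have hqN : 0 < q * N := mul_pos hq hNpos
  have e3 : (q / 2 * (N * (4 / 3)) - N * (q / 3)) * (q + N / (K : ℝ) ^ 3 * b) =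
      q * q * N / 3 + q * N * (N / (K : ℝ) ^ 3 * b) / 3 := by ring
  have e4 : C * (q / 2) ^ 2 * N = q * N * (3 / 4 * C * q) / 3 := by ring
  rw [e3, e4] at key2
  have h4 : q * N * (3 / 4 * C * q) < q * N * (N / (K : ℝ) ^ 3 * b) := mul_lt_mul_of_pos_left hρb hqN
  have hP : 0 < q * q * N := by positivity
  linarith only [key2, h4, hP]

/-- The crux with a FIXED positive stiffness parameter `b` in place of `a(v)`, guarded by `a(v) ≠ 0`
(a variant STATEMENT, shown equivalent to the crux below — not a literature fact; deliberately untagged). -/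
def DensityResponseStiffness (b : ℝ) : Prop :=
  ∀ v : ℝ → ℝ≥0∞, IsRepulsiveFiniteRange v → scatteringLength v ≠ 0 → ∀ M : ℝ, 0 < M →
    ∃ ρ₀ C : ℝ, 0 < ρ₀ ∧ 0 < C ∧ ∃ N₀ : ℕ, HoldsWith v b M ρ₀ C N₀

/-- **THE SCATTERING LENGTH IS ONLY A SWITCH.** For every fixed `b > 0` the crux is equivalent to its
unit-stiffness form on `{v : a(v) ≠ 0}`: `a(v) = 0` forces `v = 0` a.e. (LSSY App. C,
`LSSY2005_zeroScatteringLength_holds`), where the crux is the proved free chord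
(`holdsWith_zero_of_ae`); for `0 < a(v) < ∞` (`scatteringLength_ne_top_of_finiteRange`) the constants
`C·max 1 (b/a)` resp. `C·max 1 (a/b)` translate (`HoldsWith.stiffness`). [folklore] -/
theorem densityResponse_iff_stiffness {b : ℝ} (hb : 0 < b) : DensityResponse ↔ DensityResponseStiffness b := by
  constructor
  · intro h v hv ha M hM
    obtain ⟨ρ₀, C, hρ₀, hC, N₀, hH⟩ := h v hv M hM
    have hH' : HoldsWith v (scatteringLength v).toReal M ρ₀ C N₀ := hH
    obtain ⟨R₀, hR₀⟩ := hv.2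
    have hapos : 0 < (scatteringLength v).toReal :=
      ENNReal.toReal_pos ha (scatteringLength_ne_top_of_finiteRange hR₀)
    exact ⟨ρ₀, C * max 1 (b / (scatteringLength v).toReal), hρ₀, by positivity, N₀,
      hH'.stiffness hapos hb hC.le⟩
  · intro h v hv M hM
    by_cases ha : scatteringLength v = 0
    · obtain ⟨R₀, hR₀⟩ := hv.2
      have hv0 : ∀ᵐ x : Space, v ‖x‖ = 0 := LSSY2005_zeroScatteringLength_holds v R₀ hv.1 hR₀ ha
      refine ⟨1, 4, one_pos, by norm_num, 0, ?_⟩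
      rw [ha, ENNReal.toReal_zero]
      exact holdsWith_zero_of_ae hv.1 hv0 M 1 0
    · obtain ⟨ρ₀, C, hρ₀, hC, N₀, hH⟩ := h v hv ha M hM
      obtain ⟨R₀, hR₀⟩ := hv.2
      have hapos : 0 < (scatteringLength v).toReal :=
        ENNReal.toReal_pos ha (scatteringLength_ne_top_of_finiteRange hR₀)
      exact ⟨ρ₀, C * max 1 ((scatteringLength v).toReal / b), hρ₀, by positivity, N₀,
        hH.stiffness hb hapos hC.le⟩

/-- The unit-stiffness normal form of the crux: `χ(k) ≤ 2CN/(k∞² + ρ)` for admissible `v` with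
`a(v) ≠ 0`. [folklore] -/
theorem densityResponse_iff_unit : DensityResponse ↔ DensityResponseStiffness 1 :=
  densityResponse_iff_stiffness one_pos

/-- **The guard `a(v) ≠ 0` is load-bearing in the normal form**: without it the unit-stiffness
statement is FALSE (witness `v = 0`, `not_holdsWith_of_ae_pos`).  Equivalently: a proof of the crux
must USE that `v ≠ 0` a.e. — it must detect the interaction, and only that. [folklore] -/
theorem not_stiffness_without_pos {b : ℝ} (hb : 0 < b) :
    ¬ (∀ v : ℝ → ℝ≥0∞, IsRepulsiveFiniteRange v → ∀ M : ℝ, 0 < M →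
      ∃ ρ₀ C : ℝ, 0 < ρ₀ ∧ 0 < C ∧ ∃ N₀ : ℕ, HoldsWith v b M ρ₀ C N₀) := by
  intro h
  obtain ⟨ρ₀, C, hρ₀, hC, N₀, hH⟩ := h 0 ⟨measurable_const, ⟨0, fun _ _ => rfl⟩⟩ 1 one_pos
  exact not_holdsWith_of_ae_pos (v := 0) measurable_const (Filter.Eventually.of_forall fun _ => rfl)
    hb one_pos hρ₀ hC N₀ hH

/-- In particular (with `b = a(w)` for ANY admissible `w` with `a(w) > 0`, e.g. the hard sphere):
the crux's bound with a `v`-INDEPENDENT scattering length is false. [folklore] -/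
theorem not_holdsWith_free_pos {b M ρ₀ C : ℝ} (hb : 0 < b) (hM : 0 < M) (hρ₀ : 0 < ρ₀) (hC : 0 < C)
    (N₀ : ℕ) : ¬ HoldsWith 0 b M ρ₀ C N₀ :=
  not_holdsWith_of_ae_pos (v := 0) measurable_const (Filter.Eventually.of_forall fun _ => rfl) hb hM hρ₀ hC N₀

end UnitStiffness

end Summit.AtomisticToContinuum.BoseEinsteinCondensation.Theorems.DensityResponse.Negative

end
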